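import Summits.BirchSwinnertonDyer.Rank1Residual.Additive.X4RankZeroVisibleLowerBoundTransport
import Summits.BirchSwinnertonDyer.Rank1Residual.Additive.X4RankZeroVisibleLowerBoundPotMultFacts
import HarnessLib

/-!
# X4 ∧ `r = 0`, (M) rows: the hvis-currency END and the TRANSPORT-currency record socket WITHOUT Kato's
# additive bound A161 (`hKatoS`) — twins of FILE 1 §1 / FILE 3 re-pointed at n1011-p10's
# `X4RankZero.bsdp_three_potMult_of_selmerGroup_ne_bot_potMultFacts` (T-DEL98X FILE 5, p324561)
# (cell `b2b-bsdres`, team n1011; ROW T-VIS3-TATE-REC FILE 4, seat p14 GEN 6; TOOL file)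

HONEST FRAMING (cell `b2b-bsdres`, run/shared/lean/b2b/bsd-rank1-residual/, verbatim in every
file): the goal of the cell is to DELETE the COMBINATION-SHAPED residual classes of the
Birch–Swinnerton-Dyer formula for ALL analytic-rank `≤ 1` elliptic curves over `ℚ` — "full BSD
formula for every rank `≤ 1` curve in class `C`" assembled STRICTLY from published theorems — so
that the rank-`≤ 1` remainder becomes exactly the CONSTRUCTION-SHAPED classes, which are TYPED
(missing-input `Prop`s), NOT attempted. This is not "finishing BSD". Team n1011 (N11 = X4 ∧ `p = 3`):
research route on the CONSTRUCTION-SHAPED class X4; TOOL theorems only (no definition, no new named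
fact, no `sorry`); CONDITIONAL on the named facts displayed as hypotheses — here the FIVE UPPER-half
facts of the (M)-END of record after T-DEL98X (`hDel` A75, `hGZK`, `hmod`, `hmodD`, `hKatoχ` W14) plus
Cassels–Tate `hCT`; closes NO class and NO row by itself; a record over these sockets closes NOTHING
beyond its displayed binders; nothing booked; no mark / label / count moved.

## Why

FILE 1 §1 (`X4RankZero.bsdp_three_potMult_of_exists_sha_three_torsion`, p313564) and FILE 3
(`X4RankZero.bsdp_three_potMult_of_congr_of_transport_of_primeList`, p317613) end in n1011-p03's
`X4RankZero.bsdp_three_potMult_of_selmerGroup_ne_bot_noL20`, whose binder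
`hKatoS : Kato2004.rankZero_padicValNat_sha_le_sub_localTamagawa_of_additive_potGood_of_imageContainsSL2`
(A161) is IDLE on the potentially-multiplicative branch: n1011-p10's T-DEL98X FILE 5
(`X4RankZeroVisibleLowerBoundPotMultFacts.lean`, p324561) proved the twin
`X4RankZero.bsdp_three_potMult_of_selmerGroup_ne_bot_potMultFacts` displaying exactly
{`hDel`, `hGZK`, `hmod`, `hmodD`, `hKatoχ`} + `hCT` (route 2 GEN 44 token-read: 6 ↦ 5 named, nothing
added).  This file re-points the two T-VIS3-TATE sockets at that twin, so that every NEW record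
`bsdp3_visT_v<E>` displays ONE NAMED FACT FEWER (binder diff {−`hKatoS`}); the proofs are FILE 1 §1's /
FILE 3's verbatim but for the last call.  Records already landed inherit the shorter list without
re-filing (route 2's ledger note (E)); nothing is re-filed.

* `X4RankZero.bsdp_three_potMult_of_exists_sha_three_torsion_potMultFacts` — hvis currency;
* `X4RankZero.bsdp_three_potMult_of_congr_of_transport_of_primeList_potMultFacts` — transport currency
  (per place `ι_v(θ) = 1`, any kind; NO paid place; budget `1 < 3^{rank E′}`).

References: [CremonaMazur2000] §3; [AgasheStein2002] Thm. 3.1, §3.5; [Delbourgo1998] Prop. 4;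
[SilvermanAEC2009] VII.5.1 (a), X.4.2 (a), X.4.14; [MilneADT2006] I.3.3, I.3.8; [Wuthrich2014] §9.
-/

set_option autoImplicit false

noncomputable section

open scoped Classical NumberField
open IsDedekindDomain NumberField WeierstrassCurve Rat.HeightOneSpectrum
  Literature.NumberTheory.EllipticCurves Literature.NumberTheory.EllipticCurves.ModularForms
  Literature.NumberTheory.EllipticCurves.Rank1Residual
  Literature.NumberTheory.EllipticCurves.Rank1Residual.Typed
  Literature.NumberTheory.GaloisRepresentations
  Summit.BirchSwinnertonDyer.Rank1Residual.GaloisImage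

namespace Summit.BirchSwinnertonDyer.Rank1Residual.Additive

/-- **(M)-row END in hvis currency WITHOUT A161**: for `W/ℚ` globally minimal with `r_an = 0`, X4 at `3`,
`ρ̄_{E,3}` onto, `ord₃ j < 0`, `ord₃ #Ш_an ≤ 2`, a visible element `c ∈ Ш(E)[3] ∖ 0` gives `BSD(E,3)` —
conditional on Delbourgo's Prop. 4 (`hDel`), GZK (`hGZK`), modularity (`hmod`, `hmodD`), Wuthrich's
half-eigen-character divisibility (`hKatoχ`) and Cassels–Tate (`hCT`); FILE 1 §1's proof
(`Sel⁽³⁾ ↠ Ш[3]` ⇒ `Sel⁽³⁾ ≠ 0`) ending in n1011-p10's `…_of_selmerGroup_ne_bot_potMultFacts`.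
[cite: CremonaMazur2000, §3] [cite: Delbourgo1998, Prop. 4 (p. 144)] [cite: Wuthrich2014, §9 Thm. 21] -/
theorem X4RankZero.bsdp_three_potMult_of_exists_sha_three_torsion_potMultFacts
    (hDel : Delbourgo1998.prop4_rankZero_pow_dvd_constantCoeff)
    (hGZK : rank_eq_analyticRank_of_analyticRank_le_one) (hmod : hasEntireLFunction_rat)
    (hmodD : nonempty_modularParametrizationData)
    (hKatoχ : Wuthrich2014.kato_halfEigenCharIdeal_dvd_cyclotomicPrime_of_surjective)
    (hCT : exists_casselsTate_pairing (K := ℚ))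
    (W : WeierstrassCurve ℚ) [W.IsElliptic] [W.IsGloballyMinimal] (hr : W.analyticRank = 0)
    (hX : haveI : Fact (Nat.Prime 3) := ⟨Nat.prime_three⟩; ClassX4 W 3)
    (hsurj : W.HasSurjectiveModNGaloisRep 3) (hj : padicValRat 3 W.j < 0)
    {q : ℚ} (hq : shaAn W = (q : ℂ)) (hv : padicValRat 3 q ≤ 2)
    (hvis : ∃ c : W.sha, c ≠ 0 ∧ (3 : ℕ) • c = 0) :
    haveI : Fact (Nat.Prime 3) := ⟨Nat.prime_three⟩
    BSDp W 3 := by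
  haveI : Fact (Nat.Prime 3) := ⟨Nat.prime_three⟩
  obtain ⟨c, hc0, hc3⟩ := hvis
  -- `Sel^(3)(E/ℚ) ↠ Ш(E/ℚ)[3]`: a preimage of the visible class is a non-zero Selmer element
  obtain ⟨z, hz⟩ := exists_selmerToSha_eq W (n := ((3 : ℕ) : ℤ)) (by norm_num) c
    (by exact_mod_cast hc3)
  have hSel : W.selmerGroup ((3 : ℕ) : ℤ) ≠ ⊥ := by
    intro hbot
    have hmem : (z : W.galH1Torsion ((3 : ℕ) : ℤ)) ∈ (⊥ : AddSubgroup _) := hbot ▸ z.2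
    have hz0 : z = 0 := Subtype.ext ((AddSubgroup.mem_bot).mp hmem)
    exact hc0 (by rw [← hz, hz0, map_zero])
  exact X4RankZero.bsdp_three_potMult_of_selmerGroup_ne_bot_potMultFacts W hDel hGZK hmod hmodD hKatoχ
    hCT hr hX hsurj hj hq hv hSel

/-- **The T-VIS3-TATE record socket in TRANSPORT currency WITHOUT A161** ((M) rows): as FILE 3's
`X4RankZero.bsdp_three_potMult_of_congr_of_transport_of_primeList` — `E′` `3`-congruent to `E` via `θ`,
`rank E′ ≥ 1`, integer models `E₀`, `F₀`, a prime list `L ∋ 3` supporting both discriminants, and at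
every place over `L` the transport `ι_v(θ) = 1` (any kind) — with the named-fact list of the hvis END
above (`hKatoS` dropped).  `E(ℚ)` finite from `r_an = 0` (GZK), `3 ∤ #E(ℚ)` from irreducibility.
[cite: CremonaMazur2000, §3 and Table 1] [cite: AgasheStein2002, Thm. 3.1 and §3.5] [cite: SilvermanAEC2009, Thm. X.4.2 (a)] -/
theorem X4RankZero.bsdp_three_potMult_of_congr_of_transport_of_primeList_potMultFacts
    (hDel : Delbourgo1998.prop4_rankZero_pow_dvd_constantCoeff)
    (hGZK : rank_eq_analyticRank_of_analyticRank_le_one) (hmod : hasEntireLFunction_rat)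
    (hmodD : nonempty_modularParametrizationData)
    (hKatoχ : Wuthrich2014.kato_halfEigenCharIdeal_dvd_cyclotomicPrime_of_surjective)
    (hCT : exists_casselsTate_pairing (K := ℚ))
    (W : WeierstrassCurve ℚ) [W.IsElliptic] [W.IsGloballyMinimal] (hr : W.analyticRank = 0)
    (hX : haveI : Fact (Nat.Prime 3) := ⟨Nat.prime_three⟩; ClassX4 W 3)
    (hsurj : W.HasSurjectiveModNGaloisRep 3) (hj : padicValRat 3 W.j < 0)
    {q : ℚ} (hq : shaAn W = (q : ℂ)) (hv : padicValRat 3 q ≤ 2)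
    (W' : WeierstrassCurve ℚ) [W'.IsElliptic]
    (θ : geomTorsion W' ((3 : ℕ) : ℤ) ≃+ geomTorsion W ((3 : ℕ) : ℤ))
    (hθ : ∀ (σ : Field.absoluteGaloisGroup ℚ) (P : geomTorsion W' ((3 : ℕ) : ℤ)),
      θ (σ • P) = σ • θ P)
    (hrank : 1 ≤ W'.mordellWeilRank)
    {E₀ F₀ : WeierstrassCurve ℤ} (hE : E₀.map (Int.castRingHom ℚ) = W)
    (hF : F₀.map (Int.castRingHom ℚ) = W') (L : List ℕ) (h3L : 3 ∈ L)
    (hΔE : ∀ q : ℕ, q.Prime → (q : ℤ) ∣ E₀.Δ → q ∈ L)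
    (hΔF : ∀ q : ℕ, q.Prime → (q : ℤ) ∣ F₀.Δ → q ∈ L)
    (htrans : ∀ w : HeightOneSpectrum (𝓞 ℚ), (primesEquiv w : ℕ) ∈ L →
      (selmerLocalKer W (w.adicCompletion ℚ) ((3 : ℕ) : ℤ)).relIndex
        ((selmerLocalKer W' (w.adicCompletion ℚ) ((3 : ℕ) : ℤ)).map (h1Equiv θ hθ).toAddMonoidHom) = 1) :
    haveI : Fact (Nat.Prime 3) := ⟨Nat.prime_three⟩
    BSDp W 3 := by
  haveI : Fact (Nat.Prime 3) := ⟨Nat.prime_three⟩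
  haveI hfinpt : Finite W.toAffine.Point := finite_point_of_analyticRank_eq_zero W hGZK hr
  have hirr : Irr W 3 := hasIrreducibleModPGaloisRep_of_hasSurjectiveModNGaloisRep W 3 hsurj
  exact X4RankZero.bsdp_three_potMult_of_exists_sha_three_torsion_potMultFacts hDel hGZK hmod hmodD hKatoχ
    hCT W hr hX hsurj hj hq hv
    (exists_sha_ne_zero_three_of_congr_of_transport_of_primeList W W' θ hθ hfinpt
      (coprime_natCard_point_of_irr W 3 hirr) hrank hE hF L h3L hΔE hΔF htrans)

end Summit.BirchSwinnertonDyer.Rank1Residual.Additive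

end
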